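/-
Copyright (c) 2026 the pub-hodgecm-mathlib formalisation cell (harness21).  Prover seat hodgecm-mathlib-K2E3-p17 (g8), Track B «K2-LIT» / h413
(`stmt-HodgeConjecture-24833`), line `K2_E3_EllipticInputs`, leaf (nsc-S-A'), D94 brick IRR''-c1 (CENSUS v0.2 §7): the two-step peeling tower of the `GL₂`-part of `r_Q V`
for a `V` with `E(V) = {X²}`.  2026-09-04.
-/
import Summits.HodgeConjecture.HodgeConjecture.Theorems.K2E3GL3OneLinkNestedHighPieces     -- ★ IRR″-a (this seat): letters, `tch_X_ne_Y`, `isOpen_ker_b`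
import Summits.HodgeConjecture.HodgeConjecture.Theorems.K2E3GL3PeelLinked                 -- ★ S2 (K2E3-p03): `exists_peel_linked`
import Summits.HodgeConjecture.HodgeConjecture.Theorems.K2E3GL3JacquetInStagesBridge      -- ★ BRIDGE pkg (K2E3-p14): τ-weights ↔ `tch`-weights, `mu_surjective`
import Summits.HodgeConjecture.HodgeConjecture.Theorems.K2E3GL3ExponentRules              -- ★ H0 (K2E3-p25): `exists_blockEquiv_twoOne`-style setup, `block_true_mul_comm`
import Summits.HodgeConjecture.HodgeConjecture.Theorems.K2E3GL2JacquetExponents            -- ★ G1: `maxParabolicLeviChar_two_eq_iff`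
import HarnessLib

/-!
# Crux `H413` — leaf (nsc-S-A′), brick IRR″-c1: THE PEELING TOWER OF THE `GL₂`-PART OF `r_Q V` WHEN `E(V) = {X²}`

Cell `hodgecm-mathlib`, Track B; THEOREMS ONLY; count-neutral helper (`--supports stmt-HodgeConjecture-24833 --as helper`).  For a smooth `V` on `GL₃(F)` with `r_B V`
finite-dimensional, `mult V X = 2` (`X = tch(a,aν,aν)`, `a = ην½⁻¹`) and no other weight, the `GL₂`-part `W = (r_Q V) ∘ ι` (★ BRIDGE currency, `Q = P_{(2,1)}`) is peeled
twice by ★ S2 `exists_peel_linked` (the `T₂ × GL₁`-action `τ` on `r_{B₂} W` has the single weight `(a ⊠ aν) ⊗ (aν∘det)` with multiplicity `2`, ★ BRIDGE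
`finrank_weightSpace_maxParabolicLeviChar_eq_tch` ∕ `finrank_weightSpace_eq_of_comp_mu`): **`exists_peel_tower`** — `K₂ ≤ K₁ ≤ W` with `W ⁄ K₁ ≅ η∘det ≅ K₁ ⁄ K₂`,
`K₂` smooth and `r_{B₂}(K₂) = 0`.  Input of IRR″-c2 (`K₂ = 0` by ★ LIFT, then `J_ψ(W) = 0` by ★ EXT + ★ S1b, ★ S3, ★ (lev′)).

HONEST LABEL: HC_CM is proved only modulo the 7 printed citations (2 remaining named inputs: hLiu418 = stmt-HodgeConjecture-24832, h413 =
stmt-HodgeConjecture-24833) until rung 0 closes; count-neutral helper.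

## References
* [BernsteinZelevinsky1977] I. N. Bernstein, A. V. Zelevinsky, *Induced representations of reductive p-adic groups I*, Ann. Sci. ÉNS 10 (1977), Prop. 1.9, §2.3, Cor. 2.13.
* [Zelevinsky1980] A. V. Zelevinsky, *Induced representations of reductive p-adic groups II*, Ann. Sci. ÉNS 13 (1980), §1.6, Ex. 3.2, §3.2.
-/

set_option autoImplicit false
-- the mandated namespace repeats `HodgeConjecture.HodgeConjecture`, as in every `Theorems/*.lean` of this sub-problem
set_option linter.dupNamespace false

noncomputable section

open Module Module.End Representation Literature.NumberTheory.Automorphic Literature.NumberTheory.Automorphic.Zelevinsky1980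
open Literature.NumberTheory.GaloisRepresentations.IsNonarchimedeanLocalField Literature.RepresentationTheory.FiniteGroups
open scoped MatrixGroups NNReal
open Summit.HodgeConjecture.HodgeConjecture.Cruxes.H413.K2E3GL3OneLinkNestedHighPieces (tch_X_ne_Y isOpen_ker_b)
open Summit.HodgeConjecture.HodgeConjecture.Cruxes.H413.K2E3GL3PeelLinked (exists_peel_linked)
open Summit.HodgeConjecture.HodgeConjecture.Cruxes.H413.K2E3GL3JacquetInStagesBridge (finrank_weightSpace_maxParabolicLeviChar_eq_tch finrank_weightSpace_eq_of_comp_mu mu_surjective tch_eq_mu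
  exists_linearEquiv_coinvariants_stagesMap)
open Summit.HodgeConjecture.HodgeConjecture.Cruxes.H413.K2E3GL3ExponentRules (block_true_mul_comm isSmooth_normalizedJacquetGL)
open Summit.HodgeConjecture.HodgeConjecture.Cruxes.H413.K2E3GL2JacquetProdRep (exists_prodRep commute_prodRep)
open Summit.HodgeConjecture.HodgeConjecture.Cruxes.H413.K2E3GL2JacquetExponents (maxParabolicLeviChar_two_eq_iff)
open Summit.HodgeConjecture.HodgeConjecture.Cruxes.H413.K2E3JacquetExponentMultiset (subsingleton_of_forall_weightSpace_eq_bot)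

namespace Summit.HodgeConjecture.HodgeConjecture.Cruxes.H413.K2E3GL3OneLinkNestedHighTower

variable {F : Type} [Field F] [ValuativeRel F] [TopologicalSpace F] [IsNonarchimedeanLocalField F] (η : Fˣ →* ℂˣ)

/-- The swapped `τ`-weight `(aν ⊠ a) ⊗ ξ` differs from `(a ⊠ aν) ⊗ ξ` (evaluate at `(t, 1)`; `a ≠ aν`, ★ REG). [folklore] -/
theorem weight_swap_ne : (fun p : (Π b : Bool, GL {i : Fin 2 // lastBlockLabel 2 i = b} F) × GL {i : Fin 3 // (![false, false, true] : Fin 3 → Bool) i = true} F => ((maxParabolicLeviChar F 2 (η * ((unramifiedTwist F (1 / 2) : QuasiChar F).toMonoidHom)) (η * ((unramifiedTwist F (1 / 2) : QuasiChar F).toMonoidHom)⁻¹) p.1 : ℂˣ) : ℂ) * ((((η * ((unramifiedTwist F (1 / 2) : QuasiChar F).toMonoidHom))) (Matrix.GeneralLinearGroup.det p.2) : ℂˣ) : ℂ)) ≠ (fun p : (Π b : Bool, GL {i : Fin 2 // lastBlockLabel 2 i = b} F) × GL {i : Fin 3 // (![false, false, true] : Fin 3 → Bool) i = true} F => ((maxParabolicLeviChar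 F 2 (η * ((unramifiedTwist F (1 / 2) : QuasiChar F).toMonoidHom)⁻¹) (η * ((unramifiedTwist F (1 / 2) : QuasiChar F).toMonoidHom)) p.1 : ℂˣ) : ℂ) * ((((η * ((unramifiedTwist F (1 / 2) : QuasiChar F).toMonoidHom))) (Matrix.GeneralLinearGroup.det p.2) : ℂˣ) : ℂ)) := by
  intro h
  apply K2E3GL3PrincipalSeriesRegular.mul_nuHalf_inv_ne_mul_nuHalf η
  have hfun : ∀ t : (Π b : Bool, GL {i : Fin 2 // lastBlockLabel 2 i = b} F), ((maxParabolicLeviChar F 2 (η * ((unramifiedTwist F (1 / 2) : QuasiChar F).toMonoidHom)) (η * ((unramifiedTwist F (1 / 2) : QuasiChar F).toMonoidHom)⁻¹) t : ℂˣ) : ℂ) = ((maxParabolicLeviChar F 2 (η * ((unramifiedTwist F (1 / 2) : QuasiChar F).toMonoidHom)⁻¹) (η * ((unramifiedTwist F (1 / 2) : QuasiChar F).toMonoidHom)) t : ℂˣ) : ℂ) := fun t => by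
    have ht := congrFun h (t, 1)
    simpa using ht
  have hmh : maxParabolicLeviChar F 2 (η * ((unramifiedTwist F (1 / 2) : QuasiChar F).toMonoidHom)) (η * ((unramifiedTwist F (1 / 2) : QuasiChar F).toMonoidHom)⁻¹) = maxParabolicLeviChar F 2 (η * ((unramifiedTwist F (1 / 2) : QuasiChar F).toMonoidHom)⁻¹) (η * ((unramifiedTwist F (1 / 2) : QuasiChar F).toMonoidHom)) := MonoidHom.ext fun t => Units.ext (hfun t)
  exact ((maxParabolicLeviChar_two_eq_iff _ _ _ _).1 hmh).2

set_option maxHeartbeats 3200000 in  -- one long bookkeeping proof over large `normalizedJacquetGL` terms (cumulative budget)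
/-- **THE PEELING TOWER**: for `V` smooth with `r_B V` finite-dimensional, `mult V X = 2` and no other weight, the `GL₂`-part `W` of `r_Q V` has subrepresentations `K₂ ≤ K₁ ≤ W` with
`W ⁄ K₁ ≅ η∘det`, `K₁ ⁄ K₂ ≅ η∘det`, `K₂` smooth and `r_{B₂}(K₂) = 0`. [cite: BernsteinZelevinsky1977, Prop. 1.9, Cor. 2.13] [cite: Zelevinsky1980, §1.6, Ex. 3.2] -/
theorem exists_peel_tower (hη : IsOpen ((η.ker : Subgroup Fˣ) : Set Fˣ))
    (e : Fin 2 ≃ {i : Fin 3 // (![false, false, true] : Fin 3 → Bool) i = false})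
    (he : ∀ j : Fin 2, ((e j : {i : Fin 3 // (![false, false, true] : Fin 3 → Bool) i = false}) : Fin 3) = Fin.castSucc j)
    {Y : Type} [AddCommGroup Y] [Module ℂ Y] (V : Representation ℂ (GL (Fin 3) F) Y) (hV : V.IsSmooth)
    [FiniteDimensional ℂ (restrictUnipotentGL F (id : Fin 3 → Fin 3) V).Coinvariants]
    (hX : finrank ℂ ↥(⨅ m, Module.End.maxGenEigenspace (Representation.normalizedJacquetGL F (id : Fin 3 → Fin 3) V m) (((∏ a : Fin 3, ((![(η * ((unramifiedTwist F (1 / 2) : QuasiChar F).toMonoidHom)⁻¹), (η * ((unramifiedTwist F (1 / 2) : QuasiChar F).toMonoidHom)), (η * ((unramifiedTwist F (1 / 2) : QuasiChar F).toMonoidHom))] : Fin 3 → (Fˣ →* ℂˣ)) a).comp (Matrix.GeneralLinearGroup.det.comp (Pi.evalMonoidHom (fun a : Fin 3 => GL {i : Fin 3 // (id : Fin 3 → Fin 3) i = a} F) a))) m : ℂˣ) : ℂ)) = 2)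
    (h0 : ∀ ζ : (Π a : Fin 3, GL {i : Fin 3 // (id : Fin 3 → Fin 3) i = a} F) → ℂ, ζ ≠ (fun m : (Π a : Fin 3, GL {i : Fin 3 // (id : Fin 3 → Fin 3) i = a} F) => (((∏ a : Fin 3, ((![(η * ((unramifiedTwist F (1 / 2) : QuasiChar F).toMonoidHom)⁻¹), (η * ((unramifiedTwist F (1 / 2) : QuasiChar F).toMonoidHom)), (η * ((unramifiedTwist F (1 / 2) : QuasiChar F).toMonoidHom))] : Fin 3 → (Fˣ →* ℂˣ)) a).comp (Matrix.GeneralLinearGroup.det.comp (Pi.evalMonoidHom (fun a : Fin 3 => GL {i : Fin 3 // (id : Fin 3 → Fin 3) i = a} F) a))) m : ℂˣ) : ℂ)) → finrank ℂ ↥(⨅ m, Module.End.maxGenEigenspace (Representation.normalizedJacquetGL F (id : Fin 3 → Fin 3) V m) (ζ m)) = 0) :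
    ∃ (K₁ : Subrepresentation ((Representation.normalizedJacquetGL F (![false, false, true] : Fin 3 → Bool) V).comp ((MonoidHom.mulSingle (fun a : Bool => GL {i : Fin 3 // (![false, false, true] : Fin 3 → Bool) i = a} F) false).comp (reindexGL e).toMonoidHom) : Representation ℂ (GL (Fin 2) F) (Representation.restrictUnipotentGL F (![false, false, true] : Fin 3 → Bool) V).Coinvariants)) (K₂ : Subrepresentation K₁.toRepresentation),
      Nonempty (K₁.quotientRep.Equiv ((Representation.trivial ℂ (GL (Fin 2) F) ℂ).twist (η.comp (Matrix.GeneralLinearGroup.det : GL (Fin 2) F →* Fˣ)))) ∧ Nonempty (K₂.quotientRep.Equiv ((Representation.trivial ℂ (GL (Fin 2) F) ℂ).twist (η.comp (Matrix.GeneralLinearGroup.det : GL (Fin 2) F →* Fˣ)))) ∧ K₂.toRepresentation.IsSmooth ∧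
      Subsingleton (restrictUnipotentGL F (lastBlockLabel 2) K₂.toRepresentation).Coinvariants := by
  haveI : IsTopologicalRing F := inferInstance
  have hb : IsOpen ((((η * ((unramifiedTwist F (1 / 2) : QuasiChar F).toMonoidHom))).ker : Subgroup Fˣ) : Set Fˣ) := isOpen_ker_b η hη
  have hQ := isSmooth_normalizedJacquetGL (![false, false, true] : Fin 3 → Bool) hV
  have hcont : Continuous (((MonoidHom.mulSingle (fun a : Bool => GL {i : Fin 3 // (![false, false, true] : Fin 3 → Bool) i = a} F) false).comp (reindexGL e).toMonoidHom) : GL (Fin 2) F → (Π a : Bool, GL {i : Fin 3 // (![false, false, true] : Fin 3 → Bool) i = a} F)) :=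
    (_root_.continuous_mulSingle false).comp (continuous_reindexGL e)
  have hW : Representation.IsSmooth ((Representation.normalizedJacquetGL F (![false, false, true] : Fin 3 → Bool) V).comp ((MonoidHom.mulSingle (fun a : Bool => GL {i : Fin 3 // (![false, false, true] : Fin 3 → Bool) i = a} F) false).comp (reindexGL e).toMonoidHom) : Representation ℂ (GL (Fin 2) F) (Representation.restrictUnipotentGL F (![false, false, true] : Fin 3 → Bool) V).Coinvariants) := IsSmooth.comp_of_continuous _ _ hcont hQ
  have hWζ : ∀ (g : GL (Fin 2) F) (d : GL {i : Fin 3 // (![false, false, true] : Fin 3 → Bool) i = true} F), ((Representation.normalizedJacquetGL F (![false, false, true] : Fin 3 → Bool) V).comp ((MonoidHom.mulSingle (fun a : Bool => GL {i : Fin 3 // (![false, false, true] : Fin 3 → Bool) i = a} F) false).comp (reindexGL e).toMonoidHom) : Representation ℂ (GL (Fin 2) F) (Representation.restrictUnipotentGL F (![false, false, true] : Fin 3 → Bool) V).Coinvariants) g * ((Representation.normalizedJacquetGL F (![false, false, true] : Fin 3 → Bool) V).comp (MonoidHom.mulSingle (fun a : Bool => GL {i : Fin 3 // (![false, false, true]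 : Fin 3 → Bool) i = a} F) true) : Representation ℂ (GL {i : Fin 3 // (![false, false, true] : Fin 3 → Bool) i = true} F) (Representation.restrictUnipotentGL F (![false, false, true] : Fin 3 → Bool) V).Coinvariants) d = ((Representation.normalizedJacquetGL F (![false, false, true] : Fin 3 → Bool) V).comp (MonoidHom.mulSingle (fun a : Bool => GL {i : Fin 3 // (![false, false, true] : Fin 3 → Bool) i = a} F) true) : Representation ℂ (GL {i : Fin 3 // (![false, false, true] : Fin 3 → Bool) i = true} F) (Representation.restrictUnipotentGL F (![false, false, true] : Fin 3 → Bool) V).Coinvariants) d * ((Representation.normalizedJacquetGL F (![false, false, true] : Fin 3 → Bool) V).comp ((MonoidHom.mulSingle (fun a : Bool => GL {i : Fin 3 // (![false, false, true] : Fin 3 → Bool) i = a} F) false).comp (reindexGL e).toMonoidHom) : Representation ℂ (GL (Fin 2) F) (Representation.restrictUnipotentGL F (![false, false, true] : Fin 3 → Bool) V).Coinvariants) g := by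
    intro g d
    change Representation.normalizedJacquetGL F (![false, false, true] : Fin 3 → Bool) V (Pi.mulSingle false (reindexGL e g)) *
        Representation.normalizedJacquetGL F (![false, false, true] : Fin 3 → Bool) V (Pi.mulSingle true d) =
      Representation.normalizedJacquetGL F (![false, false, true] : Fin 3 → Bool) V (Pi.mulSingle true d) *
        Representation.normalizedJacquetGL F (![false, false, true] : Fin 3 → Bool) V (Pi.mulSingle false (reindexGL e g))
    rw [← map_mul, ← map_mul, (Pi.mulSingle_commute (by decide) _ _).eq]
  obtain ⟨τ, hτ₁, hτ₂⟩ := exists_prodRep _ _ hWζ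
  obtain ⟨E, -⟩ := exists_linearEquiv_coinvariants_stagesMap e he V
  haveI := Module.Finite.equiv E.symm
  have ha := fun (t : (Π b : Bool, GL {i : Fin 2 // lastBlockLabel 2 i = b} F)) w => LinearMap.congr_fun (hτ₁ t) w
  -- the `τ`-weights: `(a ⊠ aν) ⊗ ξ` twice, nothing else
  have hτX : finrank ℂ ↥(⨅ p : (Π b : Bool, GL {i : Fin 2 // lastBlockLabel 2 i = b} F) × GL {i : Fin 3 // (![false, false, true] : Fin 3 → Bool) i = true} F, maxGenEigenspace (τ p) (((maxParabolicLeviChar F 2 (η * ((unramifiedTwist F (1 / 2) : QuasiChar F).toMonoidHom)⁻¹) (η * ((unramifiedTwist F (1 / 2) : QuasiChar F).toMonoidHom)) p.1 : ℂˣ) : ℂ) * ((((η * ((unramifiedTwist F (1 / 2) : QuasiChar F).toMonoidHom))) (Matrix.GeneralLinearGroup.det p.2) : ℂˣ) : ℂ))) = 2 :=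
    (finrank_weightSpace_maxParabolicLeviChar_eq_tch e he V τ ha hτ₂ (η * ((unramifiedTwist F (1 / 2) : QuasiChar F).toMonoidHom)⁻¹) (η * ((unramifiedTwist F (1 / 2) : QuasiChar F).toMonoidHom)) (η * ((unramifiedTwist F (1 / 2) : QuasiChar F).toMonoidHom))).trans hX
  have hXY := tch_X_ne_Y η
  have hτY : finrank ℂ ↥(⨅ p : (Π b : Bool, GL {i : Fin 2 // lastBlockLabel 2 i = b} F) × GL {i : Fin 3 // (![false, false, true] : Fin 3 → Bool) i = true} F, maxGenEigenspace (τ p) (((maxParabolicLeviChar F 2 (η * ((unramifiedTwist F (1 / 2) : QuasiChar F).toMonoidHom)) (η * ((unramifiedTwist F (1 / 2) : QuasiChar F).toMonoidHom)⁻¹) p.1 : ℂˣ) : ℂ) * ((((η * ((unramifiedTwist F (1 / 2) : QuasiChar F).toMonoidHom))) (Matrix.GeneralLinearGroup.det p.2) : ℂˣ) : ℂ))) = 0 :=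
    (finrank_weightSpace_maxParabolicLeviChar_eq_tch e he V τ ha hτ₂ (η * ((unramifiedTwist F (1 / 2) : QuasiChar F).toMonoidHom)) (η * ((unramifiedTwist F (1 / 2) : QuasiChar F).toMonoidHom)⁻¹) (η * ((unramifiedTwist F (1 / 2) : QuasiChar F).toMonoidHom))).trans (h0 _ (Ne.symm hXY))
  have hτother : ∀ χ' : (Π b : Bool, GL {i : Fin 2 // lastBlockLabel 2 i = b} F) × GL {i : Fin 3 // (![false, false, true] : Fin 3 → Bool) i = true} F → ℂ, χ' ≠ (fun p : (Π b : Bool, GL {i : Fin 2 // lastBlockLabel 2 i = b} F) × GL {i : Fin 3 // (![false, false, true] : Fin 3 → Bool) i = true} F => ((maxParabolicLeviChar F 2 (η * ((unramifiedTwist F (1 / 2) : QuasiChar F).toMonoidHom)⁻¹) (η * ((unramifiedTwist F (1 / 2) : QuasiChar F).toMonoidHom)) p.1 : ℂˣ) : ℂ) * ((((η * ((unramifiedTwist F (1 / 2) : QuasiChar F).toMonoidHom))) (Matrix.GeneralLinearGroup.det p.2) : ℂˣ) : ℂ)) → finrank ℂ ↥(⨅ p : (Π b : Bool, GL {i : Fin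 2 // lastBlockLabel 2 i = b} F) × GL {i : Fin 3 // (![false, false, true] : Fin 3 → Bool) i = true} F, maxGenEigenspace (τ p) (χ' p)) = 0 := by
    intro χ' hχ'
    rw [finrank_weightSpace_eq_of_comp_mu e he V τ ha hτ₂ χ' _ (fun m => rfl)]
    refine h0 _ fun hEq => hχ' ?_
    funext p
    obtain ⟨m, rfl⟩ := mu_surjective e he p
    have h1 := congrFun hEq m
    have h2 := tch_eq_mu e he (η * ((unramifiedTwist F (1 / 2) : QuasiChar F).toMonoidHom)⁻¹) (η * ((unramifiedTwist F (1 / 2) : QuasiChar F).toMonoidHom)) (η * ((unramifiedTwist F (1 / 2) : QuasiChar F).toMonoidHom)) m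
    exact h1.trans h2
  have hsw := weight_swap_ne η
  -- first peel
  obtain ⟨K₁, ζK₁, τK₁, -, hK₁ζ, hK₁sm, hτK₁₁, hτK₁₂, hfdK₁, -, hmult₁, hother₁, ⟨e₁⟩⟩ :=
    exists_peel_linked block_true_mul_comm _ hW _ hWζ τ hτ₁ hτ₂ η hη (fun d : GL {i : Fin 3 // (![false, false, true] : Fin 3 → Bool) i = true} F => ((((η * ((unramifiedTwist F (1 / 2) : QuasiChar F).toMonoidHom))) (Matrix.GeneralLinearGroup.det d) : ℂˣ) : ℂ))
      (fun hbot => by rw [hbot, finrank_bot] at hτX; exact absurd hτX (by norm_num))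
      ((Submodule.finrank_eq_zero).1 hτY)
  haveI := hfdK₁
  -- second peel
  have hτX₁ : finrank ℂ ↥(⨅ p : (Π b : Bool, GL {i : Fin 2 // lastBlockLabel 2 i = b} F) × GL {i : Fin 3 // (![false, false, true] : Fin 3 → Bool) i = true} F, maxGenEigenspace (τK₁ p) (((maxParabolicLeviChar F 2 (η * ((unramifiedTwist F (1 / 2) : QuasiChar F).toMonoidHom)⁻¹) (η * ((unramifiedTwist F (1 / 2) : QuasiChar F).toMonoidHom)) p.1 : ℂˣ) : ℂ) * ((((η * ((unramifiedTwist F (1 / 2) : QuasiChar F).toMonoidHom))) (Matrix.GeneralLinearGroup.det p.2) : ℂˣ) : ℂ))) = 1 := by omega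
  have hτY₁ : finrank ℂ ↥(⨅ p : (Π b : Bool, GL {i : Fin 2 // lastBlockLabel 2 i = b} F) × GL {i : Fin 3 // (![false, false, true] : Fin 3 → Bool) i = true} F, maxGenEigenspace (τK₁ p) (((maxParabolicLeviChar F 2 (η * ((unramifiedTwist F (1 / 2) : QuasiChar F).toMonoidHom)) (η * ((unramifiedTwist F (1 / 2) : QuasiChar F).toMonoidHom)⁻¹) p.1 : ℂˣ) : ℂ) * ((((η * ((unramifiedTwist F (1 / 2) : QuasiChar F).toMonoidHom))) (Matrix.GeneralLinearGroup.det p.2) : ℂˣ) : ℂ))) = 0 := by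
    rw [← hother₁ _ hsw]; exact hτY
  obtain ⟨K₂, ζK₂, τK₂, -, -, hK₂sm, -, -, hfdK₂, -, hmult₂, hother₂, ⟨e₂⟩⟩ :=
    exists_peel_linked block_true_mul_comm _ hK₁sm _ hK₁ζ τK₁ hτK₁₁ hτK₁₂ η hη (fun d : GL {i : Fin 3 // (![false, false, true] : Fin 3 → Bool) i = true} F => ((((η * ((unramifiedTwist F (1 / 2) : QuasiChar F).toMonoidHom))) (Matrix.GeneralLinearGroup.det d) : ℂˣ) : ℂ))
      (fun hbot => by rw [hbot, finrank_bot] at hτX₁; exact absurd hτX₁ (by norm_num))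
      ((Submodule.finrank_eq_zero).1 hτY₁)
  haveI := hfdK₂
  refine ⟨K₁, K₂, ⟨e₁⟩, ⟨e₂⟩, hK₂sm, ?_⟩
  -- `r_{B₂}(K₂)` has no weights
  refine subsingleton_of_forall_weightSpace_eq_bot τK₂ (commute_prodRep block_true_mul_comm τK₂) fun χ' => ?_
  apply (Submodule.finrank_eq_zero).1
  by_cases hχ : χ' = (fun p : (Π b : Bool, GL {i : Fin 2 // lastBlockLabel 2 i = b} F) × GL {i : Fin 3 // (![false, false, true] : Fin 3 → Bool) i = true} F => ((maxParabolicLeviChar F 2 (η * ((unramifiedTwist F (1 / 2) : QuasiChar F).toMonoidHom)⁻¹) (η * ((unramifiedTwist F (1 / 2) : QuasiChar F).toMonoidHom)) p.1 : ℂˣ) : ℂ) * ((((η * ((unramifiedTwist F (1 / 2) : QuasiChar F).toMonoidHom))) (Matrix.GeneralLinearGroup.det p.2) : ℂˣ) : ℂ))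
  · subst hχ; beta_reduce; omega
  · rw [← hother₂ _ hχ, ← hother₁ _ hχ]
    exact hτother χ' hχ

end Summit.HodgeConjecture.HodgeConjecture.Cruxes.H413.K2E3GL3OneLinkNestedHighTower

end
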